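import Summits.ValiantsHypothesis.ValiantsHypothesis.Theses.RealTau

/-!
# ValiantsHypothesis / RealTau — item `RefinedImpliesHard` (stmt-ValiantsHypothesis-18107), closed

`RealTauRefined → VnSparseHard`: the growth-and-bookkeeping half of the route's deciding theorem
`Theses.RealTau.closes`, extracted as the stand-alone implication the target `VnSparseHard` asks
for. Given the refined real τ-bound with exponent `a`, and `C, n₀`, pick `n = 4^j ≥ n₀` with
`(n+2)^{(a(2C+3)+1+n₀)(⌊√(2n+3)⌋+4)} < 2^n`; a representation `V_n = Σ_{i<k} Π_{j<m} g_ij` with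
`k, t ≤ (n+2)^{C(s+1)}`, `m ≤ C(s+1)` would give `2^n − 1 ≤ Z_ℝ(V_n) ≤ 2^{a(m+1)}(k+t+2)^a ≤
(n+2)^{a(2C+3)(s+4)}`, contradiction. The arithmetic is copied from `Theses.RealTau.closes`
(Tavenas 2014, proof of Thm. 3.3). HONEST FRAMING: bookkeeping; `RealTauRefined` is an OPEN
conjecture; nothing here is progress on `VP ≠ VNP`.
-/

-- layout Summits/ValiantsHypothesis/ValiantsHypothesis forces the duplicated namespace component
set_option linter.dupNamespace false

namespace Summit.ValiantsHypothesis.ValiantsHypothesis.Theorems.RealTau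

open Literature.Computability.AlgebraicComplexity

/-- Polynomial loses against exponential: for every `d` some `m ≥ 1` has `(m + 2)^d < 2^m`
(copied from `Theses.RealTau.closes`). [folklore] -/
private theorem poly_lt_exp (d : ℕ) : ∃ m : ℕ, 1 ≤ m ∧ (m + 2) ^ d < 2 ^ m := by
  have ht := tendsto_pow_const_div_const_pow_of_one_lt d (show (1 : ℝ) < 2 by norm_num)
  have hev : ∀ᶠ n : ℕ in Filter.atTop, (n : ℝ) ^ d / 2 ^ n < 1 / 4 :=
    ht.eventually (gt_mem_nhds (by norm_num))
  obtain ⟨N, hN⟩ := Filter.eventually_atTop.1 hev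
  refine ⟨max N 3 - 2, by omega, ?_⟩
  set n₀ := max N 3 with hn₀
  have hn₀2 : 2 ≤ n₀ := by omega
  have h1 : (n₀ : ℝ) ^ d / 2 ^ n₀ < 1 / 4 := hN n₀ (le_max_left _ _)
  have h2 : (n₀ : ℝ) ^ d < 2 ^ (n₀ - 2) := by
    rw [div_lt_iff₀ (by positivity)] at h1
    have : (2 : ℝ) ^ n₀ = 2 ^ (n₀ - 2) * 4 := by
      rw [show n₀ = (n₀ - 2) + 2 from by omega, pow_add]
      norm_num
    linarith
  have h3 : n₀ - 2 + 2 = n₀ := by omega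
  rw [h3]
  exact_mod_cast h2

/-- Quasi-polynomial `2^{O(√n log n)}` loses against `2^n`: for every `A` some `n = 4^j` has
`(n + 2)^{A (⌊√(2n+3)⌋ + 4)} < 2^n` (copied from `Theses.RealTau.closes`; Tavenas 2014, proof of
Thm. 3.3). [cite: Tavenas2014, Thm. 3.3] -/
private theorem growth (A : ℕ) : ∃ n : ℕ, (n + 2) ^ (A * (Nat.sqrt (2 * n + 3) + 4)) < 2 ^ n := by
  obtain ⟨j, hj1, hj⟩ := poly_lt_exp (8 * A + 1)
  -- `4 (2j+1) A < 2^j`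
  have key : 4 * (2 * j + 1) * A < 2 ^ j := by
    have h1 : 8 * A ≤ (j + 2) ^ (8 * A) :=
      ((Nat.lt_two_pow_self).le).trans (Nat.pow_le_pow_left (by omega) _)
    calc 4 * (2 * j + 1) * A ≤ (j + 2) * (8 * A) := by nlinarith
      _ ≤ (j + 2) * (j + 2) ^ (8 * A) := Nat.mul_le_mul_left _ h1
      _ = (j + 2) ^ (8 * A + 1) := (pow_succ' _ _).symm
      _ < 2 ^ j := hj
  refine ⟨4 ^ j, ?_⟩
  have h4 : 4 ^ j = 2 ^ j * 2 ^ j := by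
    rw [show (4 : ℕ) = 2 * 2 from rfl, mul_pow]
  -- `⌊√(2·4^j+3)⌋ ≤ 2^{j+1}`
  have hsq : Nat.sqrt (2 * 4 ^ j + 3) ≤ 2 ^ (j + 1) := by
    have hle : 2 * 4 ^ j + 3 ≤ (2 ^ (j + 1)) ^ 2 := by
      have : (2 ^ (j + 1)) ^ 2 = 4 * 4 ^ j := by
        rw [← pow_mul, show (j + 1) * 2 = 2 * j + 2 from by ring, pow_add, pow_mul,
          show (2 : ℕ) ^ 2 = 4 from rfl]; ring
      rw [this]
      have hj4 : 4 ≤ 4 ^ j := by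
        calc 4 = 4 ^ 1 := (pow_one 4).symm
          _ ≤ 4 ^ j := Nat.pow_le_pow_right (by norm_num) hj1
      omega
    calc Nat.sqrt (2 * 4 ^ j + 3) ≤ Nat.sqrt ((2 ^ (j + 1)) ^ 2) := Nat.sqrt_le_sqrt hle
      _ = 2 ^ (j + 1) := Nat.sqrt_eq' _
  -- exponent `≤ A · 2^{j+2}`
  have hE : A * (Nat.sqrt (2 * 4 ^ j + 3) + 4) ≤ A * 2 ^ (j + 2) := by
    refine Nat.mul_le_mul_left A ?_
    have : 2 ^ (j + 2) = 2 ^ (j + 1) + 2 ^ (j + 1) := by rw [pow_succ]; ring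
    have h4' : 4 ≤ 2 ^ (j + 1) := by
      have h2j : 2 ≤ 2 ^ j := by
        calc 2 = 2 ^ 1 := (pow_one 2).symm
          _ ≤ 2 ^ j := Nat.pow_le_pow_right (by norm_num) hj1
      rw [pow_succ]; omega
    omega
  -- base `≤ 2^{2j+1}`
  have hB : 4 ^ j + 2 ≤ 2 ^ (2 * j + 1) := by
    have : 2 ^ (2 * j + 1) = 2 * 4 ^ j := by rw [pow_succ, pow_mul]; norm_num; ring
    rw [this]
    have hj4 : 4 ≤ 4 ^ j := by
      calc 4 = 4 ^ 1 := (pow_one 4).symm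
        _ ≤ 4 ^ j := Nat.pow_le_pow_right (by norm_num) hj1
    omega
  calc (4 ^ j + 2) ^ (A * (Nat.sqrt (2 * 4 ^ j + 3) + 4))
      ≤ (2 ^ (2 * j + 1)) ^ (A * (Nat.sqrt (2 * 4 ^ j + 3) + 4)) := Nat.pow_le_pow_left hB _
    _ ≤ (2 ^ (2 * j + 1)) ^ (A * 2 ^ (j + 2)) := Nat.pow_le_pow_right (Nat.two_pow_pos _) hE
    _ = 2 ^ ((2 * j + 1) * (A * 2 ^ (j + 2))) := by rw [← pow_mul]
    _ < 2 ^ 4 ^ j := Nat.pow_lt_pow_right (by norm_num) ?_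
  calc (2 * j + 1) * (A * 2 ^ (j + 2)) = 4 * (2 * j + 1) * A * 2 ^ j := by rw [pow_add]; ring
    _ < 2 ^ j * 2 ^ j := Nat.mul_lt_mul_of_pos_right key (Nat.two_pow_pos j)
    _ = 4 ^ j := h4.symm

/-- **Item `RefinedImpliesHard` (stmt-ValiantsHypothesis-18107):** `RealTauRefined → VnSparseHard`.
[cite: Tavenas2014, Thm. 3.3] -/
theorem refinedImpliesHard_proof : Theses.RealTau.RefinedImpliesHard := by
  unfold Theses.RealTau.RefinedImpliesHard Theses.RealTau.RealTauRefined
    Theses.RealTau.VnSparseHard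
  rintro ⟨a, ha⟩ C n₀
  -- the bad `n`, taken `≥ n₀` by padding the exponent
  set A : ℕ := a * (2 * C + 3) + 1 + n₀ with hA
  obtain ⟨n, hn⟩ := growth A
  have hn₀ : n₀ ≤ n := by
    have h1 : 2 ^ A ≤ (n + 2) ^ (A * (Nat.sqrt (2 * n + 3) + 4)) :=
      calc 2 ^ A ≤ (n + 2) ^ A := Nat.pow_le_pow_left (by omega) _
        _ ≤ (n + 2) ^ (A * (Nat.sqrt (2 * n + 3) + 4)) :=
            Nat.pow_le_pow_right (by omega) (Nat.le_mul_of_pos_right _ (by omega))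
    have h2 : 2 ^ A < 2 ^ n := h1.trans_lt hn
    by_contra hlt
    have : 2 ^ n ≤ 2 ^ A := Nat.pow_le_pow_right (by norm_num) (by omega)
    omega
  refine ⟨n, hn₀, ?_⟩
  intro k m t g hk hm ht hg hsum
  have hne : (∑ i, ∏ j, g i j) ≠ 0 := by
    rw [hsum]; exact map_tavenasV_ne_zero _
  have hroots := ha k m t g hg hne
  rw [hsum] at hroots
  -- `2^n - 1 ≤ Z_ℝ(V_n) ≤ 2^{a(m+1)} (k+t+2)^a` (all roots of `V_n` are real: Hutchinson/Kurtz)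
  replace hroots := (le_card_roots_toFinset_map_tavenasV n).trans hroots
  -- bookkeeping: `2^{a(m+1)} (k+t+2)^a ≤ (n+2)^{a(2C+3)(s+4)}`, `s = ⌊√(2n+3)⌋`
  set s : ℕ := Nat.sqrt (2 * n + 3) with hs
  set E : ℕ := C * (s + 1) with hE
  have hB : 2 ≤ n + 2 := by omega
  have hB1 : 1 ≤ (n + 2) ^ E := Nat.one_le_pow _ _ (by omega)
  have h2pow : 2 ^ (a * (m + 1)) ≤ (n + 2) ^ (a * (E + 1)) :=
    calc 2 ^ (a * (m + 1)) ≤ (n + 2) ^ (a * (m + 1)) := Nat.pow_le_pow_left hB _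
      _ ≤ (n + 2) ^ (a * (E + 1)) :=
          Nat.pow_le_pow_right (by omega) (Nat.mul_le_mul_left a (by omega))
  have hkt : k + t + 2 ≤ (n + 2) ^ (E + 2) := by
    have h4 : 4 ≤ (n + 2) ^ 2 :=
      calc 4 = 2 ^ 2 := by norm_num
        _ ≤ (n + 2) ^ 2 := Nat.pow_le_pow_left hB 2
    calc k + t + 2 ≤ 4 * (n + 2) ^ E := by omega
      _ ≤ (n + 2) ^ 2 * (n + 2) ^ E := Nat.mul_le_mul_right _ h4
      _ = (n + 2) ^ (E + 2) := by rw [← pow_add, Nat.add_comm 2 E]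
  have hkta : (k + t + 2) ^ a ≤ (n + 2) ^ (a * (E + 2)) :=
    calc (k + t + 2) ^ a ≤ ((n + 2) ^ (E + 2)) ^ a := Nat.pow_le_pow_left hkt a
      _ = (n + 2) ^ (a * (E + 2)) := by rw [← pow_mul, mul_comm]
  have hexp : a * (E + 1) + a * (E + 2) ≤ a * (2 * C + 3) * (s + 4) := by
    have : (E + 1) + (E + 2) ≤ (2 * C + 3) * (s + 4) := by rw [hE]; nlinarith
    calc a * (E + 1) + a * (E + 2) = a * ((E + 1) + (E + 2)) := by ring
      _ ≤ a * ((2 * C + 3) * (s + 4)) := Nat.mul_le_mul_left a this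
      _ = a * (2 * C + 3) * (s + 4) := by ring
  have key : 2 ^ n - 1 ≤ (n + 2) ^ (a * (2 * C + 3) * (s + 4)) :=
    calc 2 ^ n - 1 ≤ 2 ^ (a * (m + 1)) * (k + t + 2) ^ a := hroots
      _ ≤ (n + 2) ^ (a * (E + 1)) * (n + 2) ^ (a * (E + 2)) := Nat.mul_le_mul h2pow hkta
      _ = (n + 2) ^ (a * (E + 1) + a * (E + 2)) := by rw [← pow_add]
      _ ≤ (n + 2) ^ (a * (2 * C + 3) * (s + 4)) := Nat.pow_le_pow_right (by omega) hexp
  -- the extra factor `(n + 2)^{(1 + n₀)(s + 4)} ≥ 2` in `hn` absorbs the `- 1`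
  have hsplit : (n + 2) ^ (A * (s + 4)) =
      (n + 2) ^ (a * (2 * C + 3) * (s + 4)) * (n + 2) ^ ((1 + n₀) * (s + 4)) := by
    rw [← pow_add]; congr 1; rw [hA]; ring
  have h2le : 2 ≤ (n + 2) ^ ((1 + n₀) * (s + 4)) :=
    calc 2 ≤ n + 2 := hB
      _ ≤ (n + 2) ^ ((1 + n₀) * (s + 4)) := Nat.le_self_pow (by positivity) _
  have hLY : 2 * (n + 2) ^ (a * (2 * C + 3) * (s + 4)) ≤ (n + 2) ^ (A * (s + 4)) := by
    rw [hsplit, mul_comm]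
    exact Nat.mul_le_mul_left _ h2le
  have h1P : 1 ≤ 2 ^ n := Nat.one_le_two_pow
  have h1Y : 1 ≤ (n + 2) ^ (a * (2 * C + 3) * (s + 4)) := Nat.one_le_pow _ _ (by omega)
  have h1L : 1 ≤ (n + 2) ^ (A * (s + 4)) := Nat.one_le_pow _ _ (by omega)
  omega

end Summit.ValiantsHypothesis.ValiantsHypothesis.Theorems.RealTau
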